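import Literature.AlgebraicGeometry.HodgeTheory.FermatHodgeCharactersPrimePow
import Literature.AlgebraicGeometry.Shioda1982.ExceptionalQuadruples
import HarnessLib

/-!
# Hodge quadruples of the Fermat surface at the levels `m = 2ᵃ·3ᵇ`, part I: the Koblitz–Ogus class relation and the hexagon

Topic `Literature/AlgebraicGeometry/Shioda1982`. THEOREMS only (no definition of record, no named fact, no `sorry`).
First file of the series treating [Aoki1983, Thm. C] = [AokiShioda1983, Thm. (𝔅²ₘ) (ii)] = [Shioda1982PicardFermat,
Prop. 4 (Q′)] ("for `m > 180` every indecomposable primitive element of `𝔅²ₘ` is one of `αᵢ, βᵢ` (`m = 2m′`),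
`γⱼ` (`m = 3m″`)") at the levels `m = 2ᵃ3ᵇ` WITHOUT a prime factor `≥ 5` — the residual family of the tree's named fact
`HodgeTheory.AokiShioda1983_thmB2m_standard` once the good-prime assembly `StandardQuadrupleGoodPrime` and the range
statement `ExceptionalQuadruplesNoneUpTo630` are in (cell `pub-hfermat`, LIT lane, `SCOPING-ThmC-general.md` §24). In print
these levels are covered by Aoki's structure theory of `𝔅¹ₘ` ([Aoki1983, Thm. D, Props. 8.2–8.4]), which the tree does not
have; the route here is this formalisation's, by Koblitz–Ogus relations as in `PicardNumberTwoPowerPrime` (`2ᵏp`) and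
`PicardNumberThreePowPrime` (`3ᵏp`) — but at a level `2ᵃ3ᵇ` no class of units modulo a divisor has `≥ 10` members, so the
pigeonhole of those files is replaced by the HEXAGON relation below and a case analysis (parts II–III).

Write `m = 6n`, `𝔥 = 3n = m/2`, `𝔯 = 2n = m/3`; `o(w) = #_w s − #_{−w} s` (odd part of the multiplicity function of a
multiset `s` over `ℤ/m`), `d(y) = o(y) − o(y + 𝔥)`, `Φ_y(g) = g(y) − g(−y) − g(y + 𝔥) + g(−(y + 𝔥))`.

* **`countSub_class_twoThreePower`** (`m = 6n`, `n = 2ⁱ3ᵏ`, `i ≥ 1`, i.e. `m = 2ᵃ3ᵇ` with `a ≥ 2`, `b ≥ 1`): for a Hodge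
  multiset `s` over `ℤ/m` and `y ≡ y′ (mod 2n)` both odd and prime to `3`, **`d(y) = d(y′)`**. PROOF: the functional
  `Φ_y − Φ_{y′}` kills the reflection vectors and every Koblitz–Ogus distribution vector `D_{M,z} = 𝟙_{≡ z (M)} − e_{(m/M)z}`,
  `M ∣ m` (`KoblitzOgus.hodge_eq_combination`, [Deligne1982HodgeCycles, Rem. 7.16 (a)]): a divisor `M` of `2ᵃ3ᵇ` divides
  `m/2 = 3n` (then each `Φ` kills the congruence part, `y + 𝔥 ≡ y`, and the point `(m/M)z` is even while the four points of
  `Φ_y` are odd — this is where `4 ∣ m` enters), or divides `m/3 = 2n` (then the congruence parts of `Φ_y`, `Φ_{y′}` agree and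
  the point `(m/M)z` is a multiple of `3` while the eight points are prime to `3`), or equals `m` (zero vector).
* **`countSub_hexagon_twoThreePower`** (`9 ∣ m` as well, i.e. `3 ∣ n`): for a unit `y` the class `{y, y + 𝔯, y + 2𝔯}` consists
  of units, so **`o(y) − o(y + 𝔥) = o(y + 𝔯) − o(y + 𝔯 + 𝔥) = o(y + 2𝔯) − o(y + 2𝔯 + 𝔥)`**: on the hexagon `y + (m/6)ℤ` the
  three "diameters" carry the same difference. (For `α_y = (y, y + 𝔥, −2y, 𝔥)`, `β_y` the three differences are `0`; for
  `γ_y = (y, y + 𝔯, y + 2𝔯, −3y)` they are `1`.)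
* **`twin_or_gamma_twoThreePower`**: consequently, in a PAIR-FREE Hodge multiset `s` with four members over `ℤ/2ᵃ3ᵇ`
  (`a, b ≥ 2`), every unit member `y` is either TWINNED — `y + 𝔥 ∈ s` with the same multiplicity — or `s = γ_y =
  {y, y + 𝔯, y + 2𝔯, −3y}` (the two hexagon identities, the mass bound over the twelve distinct points `±(y + j·m/6)`,
  pair-freeness and the zero sum); **`shape_of_twin_twoThreePower`**: in the twinned case `s = {y, y + 𝔥, z, w}` with
  `z + w = −(2y + 𝔥)`, `z, w` EVEN and not both divisible by `3` — the input of part II (transfer to level `m/2`, as in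
  `PicardNumberTwoPowerPrime`). (Informal consequence, not stated separately: a pair-free Hodge quadruple at such a level has
  `0`, `2` or `3` unit members, `3` exactly for the `γ_y`.)

Cross-checks outside Lean (cell `pub-hfermat`, `pub-hfermat-lit/g39-session/towers/enum_b2.py`, brute-force enumeration of
all Hodge 4-multisets from the definition): the hexagon relation holds for every Hodge 4-multiset and every unit at
`m = 36, 72, 108, 144, 216, 288, 432, 576, 648, 864` (`255 … 94780` multisets, `0` violations; it FAILS at `m = 96 = 2⁵·3`, where
`y + 𝔯` need not be prime to `3`), twin-or-gamma and the unit counts `{0, 2, 3}` hold for all `84 … 1252` indecomposable ones,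
and the non-standard indecomposables there are exactly the `110` (`94` when `16 ∤ m`) lifts of the exceptional quadruples of
the levels `12, 18, 24, 36, 48, 72` of [MeyerNeutsch1981Fermatquadrupel, Tabelle 1]; `|𝔅²₁₄₄| = 2920` multisets agrees with
the cell's two-implementation census (`data/hodge_fermat_n2.json`).

HONEST FRAMING (cell `pub-hfermat`): explicit algebraic cycles for specific Hodge classes on Fermat/Delsarte varieties; residual
open instances listed; no claim on general Hodge. (Surface classes are algebraic by Lefschetz (1,1); this file proves count
identities for Shioda's Hodge condition towards a printed structure theorem; no cycle is constructed here.)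

## References
* [Aoki1983] N. Aoki, *On some arithmetic problems related to the Hodge cycles on the Fermat varieties*, Math. Ann. 266
  (1983) 23–54 — Thm. C p. 47 (proof §9 pp. 47–54 for `m > 630`), Prop. 2.2 (level change), Thm. D.
* [AokiShioda1983] N. Aoki, T. Shioda, *Generators of the Néron–Severi group of a Fermat surface*, Progr. Math. 35 (1983)
  1–12 — §2 Thm. (𝔅²ₘ) (ii).
* [Shioda1982PicardFermat] T. Shioda, *On the Picard number of a Fermat surface*, J. Fac. Sci. Univ. Tokyo IA 28 (1982)
  725–734 — Lemma 1, Prop. 4 (Q′) p. 729.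
* [Deligne1982HodgeCycles] P. Deligne, *Hodge cycles on abelian varieties*, LNM 900 (1982), Rem. 7.16 (a) (Koblitz–Ogus);
  through the tree's `KoblitzOgus.hodge_eq_combination`.
* [MeyerNeutsch1981Fermatquadrupel] W. Meyer, W. Neutsch, *Fermatquadrupel*, Math. Ann. 256 (1981) 51–62 — Tabelle 1 p. 54.
* [Shioda1979PJA] T. Shioda, Proc. Japan Acad. 55A (1979) 111–114, §1 (2), (3) (the Hodge condition `IsHodgeMultiset`).
-/

namespace Literature.AlgebraicGeometry.Shioda1982

open Finset Multiset
open Literature.AlgebraicGeometry.HodgeTheory Literature.AlgebraicGeometry.HodgeTheory.FermatCharacter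

section TwoThreePower

variable {m n i k : ℕ} [NeZero m]

/-- `𝔥 = 3n = m/2` as a residue modulo `m = 6n`. -/
local notation "𝔥" => (((3 * n : ℕ)) : ZMod m)
/-- `𝔯 = 2n = m/3` as a residue modulo `m = 6n`. -/
local notation "𝔯" => (((2 * n : ℕ)) : ZMod m)
/-- `𝔫 = n = m/6` as a residue modulo `m = 6n`. -/
local notation "𝔫" => (((n : ℕ)) : ZMod m)

/-! ### The level `m = 6n = 2ⁱ⁺¹·3ᵏ⁺¹`: elementary facts -/

omit [NeZero m] in
/-- `m = 2ⁱ⁺¹ 3ᵏ⁺¹`. [folklore] -/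
private theorem m_eq_pow (hm : m = 6 * n) (hn : n = 2 ^ i * 3 ^ k) : m = 2 ^ (i + 1) * 3 ^ (k + 1) := by
  rw [hm, hn]; ring

omit [NeZero m] in
/-- `0 < n`. [folklore] -/
private theorem n_pos (hn : n = 2 ^ i * 3 ^ k) : 0 < n := by
  rw [hn]; positivity

omit [NeZero m] in
/-- `2 ∣ n` when `i ≥ 1`. [folklore] -/
private theorem two_dvd_n (hn : n = 2 ^ i * 3 ^ k) (hi : 1 ≤ i) : 2 ∣ n := by
  obtain ⟨i', rfl⟩ := Nat.exists_eq_add_of_le' hi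
  exact ⟨2 ^ i' * 3 ^ k, by rw [hn]; ring⟩

omit [NeZero m] in
/-- `3 ∣ n` when `k ≥ 1`. [folklore] -/
private theorem three_dvd_n (hn : n = 2 ^ i * 3 ^ k) (hk : 1 ≤ k) : 3 ∣ n := by
  obtain ⟨k', rfl⟩ := Nat.exists_eq_add_of_le' hk
  exact ⟨2 ^ i * 3 ^ k', by rw [hn]; ring⟩

/-! ### Arithmetic in `ℤ/6n` -/

omit [NeZero m] in
/-- `3n + 3n = 0` in `ℤ/6n`. [folklore] -/
private theorem h_add_h (hm : m = 6 * n) : 𝔥 + 𝔥 = 0 := by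
  have e : (((3 * n : ℕ) : ZMod m)) + ((3 * n : ℕ) : ZMod m) = ((m : ℕ) : ZMod m) := by
    push_cast; rw [hm]; push_cast; ring
  rw [e, ZMod.natCast_self]

omit [NeZero m] in
/-- `−3n = 3n`. [folklore] -/
private theorem neg_h (hm : m = 6 * n) : -𝔥 = 𝔥 := by
  linear_combination -(h_add_h hm)

omit [NeZero m] in
/-- `−(y + 3n) = −y + 3n`. [folklore] -/
private theorem neg_add_h (hm : m = 6 * n) (y : ZMod m) : -(y + 𝔥) = -y + 𝔥 := by
  rw [neg_add, neg_h hm]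

omit [NeZero m] in
/-- `3 · 2n = 0` in `ℤ/6n`. [folklore] -/
private theorem three_mul_r (hm : m = 6 * n) : (3 : ZMod m) * 𝔯 = 0 := by
  have e : (3 : ZMod m) * ((2 * n : ℕ) : ZMod m) = ((m : ℕ) : ZMod m) := by
    push_cast; rw [hm]; push_cast; ring
  rw [e, ZMod.natCast_self]

omit [NeZero m] in
/-- `⟨3n⟩ = 3n`. [folklore] -/
private theorem val_h (hm : m = 6 * n) (hn0 : 0 < n) : (𝔥 : ZMod m).val = 3 * n := by
  rw [ZMod.val_natCast, Nat.mod_eq_of_lt (by omega)]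

omit [NeZero m] in
/-- `⟨2n⟩ = 2n`. [folklore] -/
private theorem val_r (hm : m = 6 * n) (hn0 : 0 < n) : (𝔯 : ZMod m).val = 2 * n := by
  rw [ZMod.val_natCast, Nat.mod_eq_of_lt (by omega)]

/-- Adding a multiple of `M` does not change the residue mod `M` (`M ∣ m`). [folklore] -/
private theorem mod_add_of_dvd {M : ℕ} (hM : M ∣ m) (x : ZMod m) {c : ZMod m} (hc : M ∣ c.val) :
    (x + c).val % M = x.val % M := by
  obtain ⟨t, ht⟩ := hc
  rw [ZMod.val_add, Nat.mod_mod_of_dvd _ hM, ht, Nat.add_mul_mod_self_left]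

/-- `x ≡ x' (mod M)` is stable under adding a constant (`M ∣ m`). [folklore] -/
private theorem mod_congr_add {M : ℕ} (hM : M ∣ m) {x x' : ZMod m} (h : x.val % M = x'.val % M) (c : ZMod m) :
    (x + c).val % M = (x' + c).val % M := by
  rw [ZMod.val_add, ZMod.val_add, Nat.mod_mod_of_dvd _ hM, Nat.mod_mod_of_dvd _ hM, Nat.add_mod, h, ← Nat.add_mod]

/-- `x ≡ x' (mod M)` iff the reductions mod `M` agree. [folklore] -/
private theorem castHom_eq_iff {M : ℕ} (hM : M ∣ m) {x x' : ZMod m} :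
    (ZMod.castHom hM (ZMod M)) x = (ZMod.castHom hM (ZMod M)) x' ↔ x.val % M = x'.val % M := by
  rw [ZMod.castHom_apply, ZMod.castHom_apply, ZMod.cast_eq_val, ZMod.cast_eq_val, ZMod.natCast_eq_natCast_iff']

/-- `x ≡ x' (mod M)` is stable under negation (`M ∣ m`). [folklore] -/
private theorem mod_congr_neg {M : ℕ} (hM : M ∣ m) {x x' : ZMod m} (h : x.val % M = x'.val % M) :
    (-x).val % M = (-x').val % M := by
  rw [← castHom_eq_iff hM] at h ⊢
  rw [map_neg, map_neg, h]

/-- `p ∣ ⟨x⟩` iff `x` reduces to `0` modulo `p` (`p ∣ m`). [folklore] -/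
private theorem dvd_val_iff_cast {p : ℕ} (hp : p ∣ m) (x : ZMod m) : p ∣ x.val ↔ ZMod.castHom hp (ZMod p) x = 0 := by
  rw [ZMod.castHom_apply, ZMod.cast_eq_val, ZMod.natCast_eq_zero_iff]

/-- A divisor `p` of `m` divides `⟨−x⟩` iff it divides `⟨x⟩`. [folklore] -/
private theorem dvd_val_neg_iff {p : ℕ} (hp : p ∣ m) (x : ZMod m) : p ∣ (-x).val ↔ p ∣ x.val := by
  rw [dvd_val_iff_cast hp, dvd_val_iff_cast hp, map_neg, neg_eq_zero]

/-- A divisor `p` of `m` dividing `⟨c⟩` divides `⟨x + c⟩` iff it divides `⟨x⟩`. [folklore] -/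
private theorem dvd_val_add_iff {p : ℕ} (hp : p ∣ m) (x : ZMod m) {c : ZMod m} (hc : p ∣ c.val) :
    p ∣ (x + c).val ↔ p ∣ x.val := by
  rw [Nat.dvd_iff_mod_eq_zero, Nat.dvd_iff_mod_eq_zero, mod_add_of_dvd hp x hc]

omit [NeZero m] in
/-- `2 ∣ m`. [folklore] -/
private theorem two_dvd_m (hm : m = 6 * n) : 2 ∣ m := ⟨3 * n, by rw [hm]; ring⟩

omit [NeZero m] in
/-- `3 ∣ m`. [folklore] -/
private theorem three_dvd_m (hm : m = 6 * n) : 3 ∣ m := ⟨2 * n, by rw [hm]; ring⟩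

/-- The four points `y, −y, y + 3n, −(y + 3n)` attached to an odd `y` prime to `3` are odd and prime to `3` (`2 ∣ n`). [folklore] -/
private theorem odd_class (hm : m = 6 * n) (hn0 : 0 < n) (h2 : 2 ∣ n) {y : ZMod m} (hy : ¬ 2 ∣ y.val) (hy3 : ¬ 3 ∣ y.val) :
    (¬ 2 ∣ (-y).val ∧ ¬ 3 ∣ (-y).val) ∧ (¬ 2 ∣ (y + 𝔥).val ∧ ¬ 3 ∣ (y + 𝔥).val) ∧
      (¬ 2 ∣ (-(y + 𝔥)).val ∧ ¬ 3 ∣ (-(y + 𝔥)).val) := by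
  have h2h : 2 ∣ (𝔥 : ZMod m).val := by rw [val_h hm hn0]; exact Dvd.dvd.mul_left h2 3
  have h3h : 3 ∣ (𝔥 : ZMod m).val := by rw [val_h hm hn0]; exact Dvd.intro n rfl
  have a2 : ¬ 2 ∣ (y + 𝔥).val := by rwa [dvd_val_add_iff (two_dvd_m hm) y h2h]
  have a3 : ¬ 3 ∣ (y + 𝔥).val := by rwa [dvd_val_add_iff (three_dvd_m hm) y h3h]
  exact ⟨⟨by rwa [dvd_val_neg_iff (two_dvd_m hm)], by rwa [dvd_val_neg_iff (three_dvd_m hm)]⟩, ⟨a2, a3⟩,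
    ⟨by rwa [dvd_val_neg_iff (two_dvd_m hm)], by rwa [dvd_val_neg_iff (three_dvd_m hm)]⟩⟩

omit [NeZero m] in
/-- The divisors of `m = 2ⁱ⁺¹3ᵏ⁺¹`: each divides `3n = m/2`, or divides `2n = m/3`, or equals `m`. [folklore] -/
private theorem dvd_cases (hm : m = 6 * n) (hn : n = 2 ^ i * 3 ^ k) {M : ℕ} (hM : M ∣ m) :
    M ∣ 3 * n ∨ M ∣ 2 * n ∨ M = m := by
  rw [m_eq_pow hm hn] at hM
  obtain ⟨a, b, ha, hb, rfl⟩ := Nat.dvd_mul.mp hM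
  obtain ⟨s, hs, rfl⟩ := (Nat.dvd_prime_pow Nat.prime_two).mp ha
  obtain ⟨t, ht, rfl⟩ := (Nat.dvd_prime_pow Nat.prime_three).mp hb
  by_cases hs' : s ≤ i
  · left
    rw [show 3 * n = 2 ^ i * 3 ^ (k + 1) by rw [hn]; ring]
    exact Nat.mul_dvd_mul (pow_dvd_pow 2 hs') (pow_dvd_pow 3 ht)
  · have hsi : s = i + 1 := by omega
    subst hsi
    by_cases ht' : t ≤ k
    · right; left
      rw [show 2 * n = 2 ^ (i + 1) * 3 ^ k by rw [hn]; ring]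
      exact Nat.mul_dvd_mul dvd_rfl (pow_dvd_pow 3 ht')
    · have htk : t = k + 1 := by omega
      subst htk
      right; right
      rw [m_eq_pow hm hn]

/-! ### The four-point functional `Φ_y` and the Koblitz–Ogus vectors of level `6n` -/

variable (n) in
/-- The four-point functional `Φ_y(g) = g(y) − g(−y) − g(y + 3n) + g(−(y + 3n))` on functions on `ℤ/6n`. [folklore] -/
private def phi (y : ZMod m) (g : ZMod m → ℚ) : ℚ :=
  g y - g (-y) - g (y + 𝔥) + g (-(y + 𝔥))

omit [NeZero m] in
/-- `Φ_y` is additive. [folklore] -/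
private theorem phi_add (y : ZMod m) (g g' : ZMod m → ℚ) :
    phi n y (fun w ↦ g w + g' w) = phi n y g + phi n y g' := by
  simp only [phi]
  ring

omit [NeZero m] in
/-- `Φ_y` is homogeneous. [folklore] -/
private theorem phi_mul (y : ZMod m) (c : ℚ) (g : ZMod m → ℚ) :
    phi n y (fun w ↦ c * g w) = c * phi n y g := by
  simp only [phi]
  ring

omit [NeZero m] in
/-- `Φ_y` commutes with finite sums. [folklore] -/
private theorem phi_sum (y : ZMod m) {ι : Type*} (t : Finset ι) (g : ι → ZMod m → ℚ) :
    phi n y (fun w ↦ ∑ j ∈ t, g j w) = ∑ j ∈ t, phi n y (g j) := by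
  simp only [phi, Finset.sum_add_distrib, Finset.sum_sub_distrib]

omit [NeZero m] in
/-- `Φ_y` kills negation-invariant functions. [folklore] -/
private theorem phi_eq_zero_of_even (y : ZMod m) {g : ZMod m → ℚ} (hg : ∀ w, g (-w) = g w) :
    phi n y g = 0 := by
  simp only [phi, hg]
  ring

/-- The Koblitz–Ogus distribution vector of level `M ∣ m` through `z` (as in `KoblitzOgus.hodge_eq_combination`):
`w ↦ [w ≡ z (mod M)] − [(m/M)·z = w]`. [cite: Deligne1982HodgeCycles, Rem. 7.16 (a)] -/
private def koD (m : ℕ) (M : ℕ) (z w : ZMod m) : ℚ :=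
  (if w.val % M = z.val % M then (1 : ℚ) else 0) - (if ((m / M : ℕ) : ZMod m) * z = w then 1 else 0)

omit [NeZero m] in
/-- **A point mass at a point with a divisor `p ∣ m` (`p ∣ ⟨w⟩`) is invisible to `Φ_y`** when the four points of `Φ_y` are prime to
`p`. [folklore] -/
private theorem phi_point_dvd {p : ℕ} {y w : ZMod m} (hw : p ∣ w.val) (h₀ : ¬ p ∣ y.val) (h₁ : ¬ p ∣ (-y).val)
    (h₂ : ¬ p ∣ (y + 𝔥).val) (h₃ : ¬ p ∣ (-(y + 𝔥)).val) :
    phi n y (fun v ↦ if w = v then (1 : ℚ) else 0) = 0 := by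
  have ne : ∀ v : ZMod m, ¬ p ∣ v.val → w ≠ v := by
    rintro v hv rfl
    exact hv hw
  simp only [phi, if_neg (ne y h₀), if_neg (ne _ h₁), if_neg (ne _ h₂), if_neg (ne _ h₃)]
  ring

/-- The congruence indicator `[· ≡ z (mod M)]` is killed by `Φ_y` for every `M ∣ 3n` (`y + 3n ≡ y`). [folklore] -/
private theorem phi_congr_eq_zero (hm : m = 6 * n) (hn0 : 0 < n) (y z : ZMod m) {M : ℕ} (hM : M ∣ 3 * n) :
    phi n y (fun v ↦ if v.val % M = z.val % M then (1 : ℚ) else 0) = 0 := by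
  have hMm : M ∣ m := Nat.dvd_trans hM ⟨2, by rw [hm]; ring⟩
  have hc : M ∣ (𝔥 : ZMod m).val := by rw [val_h hm hn0]; exact hM
  have e3 : -(y + 𝔥) = -y + 𝔥 := neg_add_h hm y
  simp only [phi, e3, mod_add_of_dvd hMm _ hc]
  ring

/-- The congruence indicator modulo `M ∣ m` is seen by `Φ_y` only through the class of `y` modulo `M`. [folklore] -/
private theorem phi_congr_M {M : ℕ} (hM : M ∣ m) {y y' : ZMod m} (hyy' : y.val % M = y'.val % M) (z : ZMod m) :
    phi n y (fun v ↦ if v.val % M = z.val % M then (1 : ℚ) else 0) =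
      phi n y' (fun v ↦ if v.val % M = z.val % M then (1 : ℚ) else 0) := by
  have a1 : (-y).val % M = (-y').val % M := mod_congr_neg hM hyy'
  have a2 : (y + 𝔥).val % M = (y' + 𝔥).val % M := mod_congr_add hM hyy' _
  have a3 : (-(y + 𝔥)).val % M = (-(y' + 𝔥)).val % M := mod_congr_neg hM a2
  simp only [phi, hyy', a1, a2, a3]

/-- The distribution vector of level `m` is zero. [folklore] -/
private theorem koD_self (z w : ZMod m) : koD m m z w = 0 := by
  have hm0 : m ≠ 0 := NeZero.ne m
  simp only [koD, Nat.mod_eq_of_lt (ZMod.val_lt _), Nat.div_self (Nat.pos_of_ne_zero hm0), Nat.cast_one, one_mul]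
  by_cases hzw : w = z
  · rw [if_pos (by rw [hzw]), if_pos hzw.symm, sub_self]
  · rw [if_neg (fun e ↦ hzw (ZMod.val_injective _ e)), if_neg (fun e ↦ hzw e.symm), sub_self]

/-- The point `(m/M)·z` of `D_{M,z}` has `p ∣ ⟨(m/M)z⟩` whenever `M ∣ m/p` (`p ∣ m`): `m/M = p · ((m/p)/M)`. [folklore] -/
private theorem point_dvd {p M : ℕ} (hp : 0 < p) (hpm : p ∣ m) (hM : M ∣ m / p) (hM0 : 0 < M) (z : ZMod m) :
    p ∣ ((((m / M : ℕ)) : ZMod m) * z).val := by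
  obtain ⟨c, hc⟩ := hM
  obtain ⟨e, he⟩ := hpm
  have hmM : m / M = p * c := by
    rw [he, Nat.mul_div_cancel_left _ hp] at hc
    rw [he, hc, show p * (M * c) = M * (p * c) by ring, Nat.mul_div_cancel_left _ hM0]
  rw [hmM, show ((((p * c : ℕ)) : ZMod m)) * z = (((p * (c * z.val) : ℕ)) : ZMod m) by
    push_cast; rw [ZMod.natCast_zmod_val]; ring, ZMod.val_natCast]
  exact (Nat.dvd_mod_iff ⟨e, he⟩).mpr (Dvd.intro _ rfl)

/-- **The distribution vectors of `ℤ/2ᵃ3ᵇ` are killed by `Φ_y − Φ_{y′}`** for `y ≡ y′ (mod 2n)` odd and prime to `3`: a divisor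
`M` of `m` divides `3n` (each `Φ` kills the congruence part; the point `(m/M)z` is even, the four points are odd), or divides
`2n` (the congruence parts agree; the point is a multiple of `3`, the eight points are prime to `3`), or `M = m` (zero vector).
[folklore] -/
private theorem phi_sub_phi_koD (hm : m = 6 * n) (hn : n = 2 ^ i * 3 ^ k) (hi : 1 ≤ i) {M : ℕ} (hM : M ∈ m.divisors)
    {y y' : ZMod m} (hy : ¬ 2 ∣ y.val) (hy3 : ¬ 3 ∣ y.val) (hy' : ¬ 2 ∣ y'.val) (hy3' : ¬ 3 ∣ y'.val)
    (hyy' : y.val % (2 * n) = y'.val % (2 * n)) (z : ZMod m) :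
    phi n y (koD m M z) - phi n y' (koD m M z) = 0 := by
  have hn0 : 0 < n := n_pos hn
  have hMdvd : M ∣ m := Nat.dvd_of_mem_divisors hM
  have hM0 : 0 < M := Nat.pos_of_mem_divisors hM
  obtain ⟨⟨a2, a3⟩, ⟨b2, b3⟩, ⟨c2, c3⟩⟩ := odd_class hm hn0 (two_dvd_n hn hi) hy hy3
  obtain ⟨⟨a2', a3'⟩, ⟨b2', b3'⟩, ⟨c2', c3'⟩⟩ := odd_class hm hn0 (two_dvd_n hn hi) hy' hy3'
  -- split `koD` into its congruence part and its point part
  have split : ∀ x : ZMod m, phi n x (koD m M z) =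
      phi n x (fun v ↦ if v.val % M = z.val % M then (1 : ℚ) else 0) -
        phi n x (fun v ↦ if ((m / M : ℕ) : ZMod m) * z = v then (1 : ℚ) else 0) := by
    intro x
    simp only [phi, koD]
    ring
  rcases dvd_cases hm hn hMdvd with hM3 | hM2 | hMm
  · -- `M ∣ 3n = m/2`: the point is even
    have hw : 2 ∣ ((((m / M : ℕ)) : ZMod m) * z).val :=
      point_dvd two_pos (two_dvd_m hm) (by rwa [hm, show 6 * n = 2 * (3 * n) by ring, Nat.mul_div_cancel_left _ two_pos]) hM0 z
    rw [split, split, phi_congr_eq_zero hm hn0 y z hM3, phi_congr_eq_zero hm hn0 y' z hM3,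
      phi_point_dvd hw hy a2 b2 c2, phi_point_dvd hw hy' a2' b2' c2']
    ring
  · -- `M ∣ 2n = m/3`: the point is a multiple of `3`; congruence parts agree
    have hw : 3 ∣ ((((m / M : ℕ)) : ZMod m) * z).val :=
      point_dvd three_pos (three_dvd_m hm)
        (by rwa [hm, show 6 * n = 3 * (2 * n) by ring, Nat.mul_div_cancel_left _ three_pos]) hM0 z
    have hyyM : y.val % M = y'.val % M := by
      rw [← Nat.mod_mod_of_dvd _ hM2, hyy', Nat.mod_mod_of_dvd _ hM2]
    rw [split, split, phi_congr_M hMdvd hyyM z, phi_point_dvd hw hy3 a3 b3 c3, phi_point_dvd hw hy3' a3' b3' c3']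
    ring
  · -- `M = m`
    subst hMm
    have hz : koD M M z = fun _ ↦ 0 := funext (koD_self z)
    rw [hz]
    simp [phi]

/-- **The bridge from Koblitz–Ogus to count identities.** A linear functional on functions `ℤ/m → ℚ` that kills the
negation-invariant functions and every distribution vector `D_{M,z}` kills the multiplicity function of a Hodge multiset.
[cite: Deligne1982HodgeCycles, Rem. 7.16 (a)] -/
private theorem functional_count_eq_zero {s : Multiset (ZMod m)} (hs : IsHodgeMultiset s) (L : (ZMod m → ℚ) → ℚ)
    (hadd : ∀ g g' : ZMod m → ℚ, L (fun z ↦ g z + g' z) = L g + L g')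
    (hmul : ∀ (c : ℚ) (g : ZMod m → ℚ), L (fun z ↦ c * g z) = c * L g)
    (hsum : ∀ {ι : Type} (t : Finset ι) (g : ι → ZMod m → ℚ), L (fun z ↦ ∑ j ∈ t, g j z) = ∑ j ∈ t, L (g j))
    (heven : ∀ g : ZMod m → ℚ, (∀ z, g (-z) = g z) → L g = 0)
    (hko : ∀ M ∈ m.divisors, ∀ y : ZMod m, L (koD m M y) = 0) :
    L (fun w ↦ (count w s : ℚ)) = 0 := by
  classical
  obtain ⟨cr, cd, hrep⟩ := Literature.NumberTheory.Transcendental.KoblitzOgus.hodge_eq_combination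
    (N := m) (fun x ↦ (count x s : ℚ)) (fun u hu ↦ hs.sum_count_mul_bern_eq_zero hu)
  have hf : (fun w ↦ (count w s : ℚ)) =
      fun w ↦ (∑ a : ZMod m, cr a * ((if a = w then (1 : ℚ) else 0) + (if -a = w then 1 else 0))) +
        ∑ M ∈ m.divisors, ∑ y : ZMod m, cd M y * koD m M y w := funext hrep
  rw [hf, hadd, hsum, hsum]
  have hA : ∀ a : ZMod m, L (fun w ↦ cr a * ((if a = w then (1 : ℚ) else 0) + (if -a = w then 1 else 0))) = 0 :=
    fun a ↦ by
      rw [hmul, heven _ fun w ↦ ?_, mul_zero]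
      rw [add_comm]
      congr 1
      · simp only [neg_inj]
      · simp only [eq_neg_iff_add_eq_zero, neg_eq_iff_add_eq_zero]
  have hB : ∀ M ∈ m.divisors, L (fun w ↦ ∑ y : ZMod m, cd M y * koD m M y w) = 0 := fun M hM ↦ by
    rw [hsum]
    refine Finset.sum_eq_zero fun y _ ↦ ?_
    rw [hmul, hko M hM y, mul_zero]
  rw [Finset.sum_eq_zero fun a _ ↦ hA a, Finset.sum_eq_zero hB, add_zero]

omit [NeZero m] in
/-- From a rational identity between counts to the integer one. [folklore] -/
private theorem int_of_rat_eq {a b : ℤ} (h : ((a : ℚ)) = b) : a = b := by exact_mod_cast h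

/-- **Koblitz–Ogus at level `6n = 2ᵃ3ᵇ` (`a ≥ 2`, `b ≥ 1`), the class relation.** For a Hodge multiset `s` over `ℤ/2ᵃ3ᵇ`,
`o(w) = #_w s − #_{−w} s` the odd part of its multiplicity function and `d(y) = o(y) − o(y + 3n)` (`3n = m/2`):
**`d(y) = d(y′)` whenever `y ≡ y′ (mod 2n = m/3)` are odd and prime to `3`** (`d` is constant on each class of units modulo
`m/3`). PROOF: the tree's PROVED `KoblitzOgus.hodge_eq_combination` and `phi_sub_phi_koD`. This formalisation's lemma (the
source proves the span statement; the analogue of `countSub_class_twoPowPrime` at `2ᵏp`, where the classes are modulo `m/p`).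
[cite: Deligne1982HodgeCycles, Rem. 7.16 (a)] [cite: Aoki1983, Prop. 2.2] -/
theorem countSub_class_twoThreePower (hm : m = 6 * n) (hn : n = 2 ^ i * 3 ^ k) (hi : 1 ≤ i) {s : Multiset (ZMod m)}
    (hs : IsHodgeMultiset s) {y y' : ZMod m} (hy : ¬ 2 ∣ y.val) (hy3 : ¬ 3 ∣ y.val) (hy' : ¬ 2 ∣ y'.val)
    (hy3' : ¬ 3 ∣ y'.val) (hyy' : y.val % (2 * n) = y'.val % (2 * n)) :
    ((count y s : ℤ) - count (-y) s) - ((count (y + 𝔥) s : ℤ) - count (-(y + 𝔥)) s) =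
      ((count y' s : ℤ) - count (-y') s) - ((count (y' + 𝔥) s : ℤ) - count (-(y' + 𝔥)) s) := by
  have key := functional_count_eq_zero hs (fun g ↦ phi n y g - phi n y' g)
    (fun g g' ↦ by rw [phi_add, phi_add]; ring) (fun c g ↦ by rw [phi_mul, phi_mul]; ring)
    (fun t g ↦ by rw [phi_sum, phi_sum, Finset.sum_sub_distrib])
    (fun g hg ↦ by rw [phi_eq_zero_of_even y hg, phi_eq_zero_of_even y' hg, sub_self])
    (fun M hM z ↦ phi_sub_phi_koD hm hn hi hM hy hy3 hy' hy3' hyy' z)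
  simp only [phi] at key
  apply int_of_rat_eq
  push_cast at key ⊢
  linear_combination key

/-! ### The hexagon relation (`9 ∣ m`): the class of a unit `y` modulo `m/3` is `{y, y + 2n, y + 4n}`, all units -/

/-- `y + 2n` is odd and prime to `3` when `y` is and `3 ∣ n`; and `y + 2n ≡ y (mod 2n)`. [folklore] -/
private theorem add_r_class (hm : m = 6 * n) (hn0 : 0 < n) (h3 : 3 ∣ n) {y : ZMod m} (hy : ¬ 2 ∣ y.val) (hy3 : ¬ 3 ∣ y.val) :
    ¬ 2 ∣ (y + 𝔯).val ∧ ¬ 3 ∣ (y + 𝔯).val ∧ (y + 𝔯).val % (2 * n) = y.val % (2 * n) := by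
  have h2r : 2 ∣ (𝔯 : ZMod m).val := by rw [val_r hm hn0]; exact Dvd.intro n rfl
  have h3r : 3 ∣ (𝔯 : ZMod m).val := by rw [val_r hm hn0]; exact Dvd.dvd.mul_left h3 2
  have hrr : 2 * n ∣ (𝔯 : ZMod m).val := by rw [val_r hm hn0]
  refine ⟨by rwa [dvd_val_add_iff (two_dvd_m hm) y h2r], by rwa [dvd_val_add_iff (three_dvd_m hm) y h3r], ?_⟩
  exact mod_add_of_dvd ⟨3, by rw [hm]; ring⟩ y hrr

/-- **The hexagon relation at level `2ᵃ3ᵇ`, `a, b ≥ 2`.** For a Hodge multiset `s` over `ℤ/m`, `m = 6n`, `n = 2ⁱ3ᵏ` with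
`i, k ≥ 1`, and a unit `y` (odd, prime to `3`): with `o(w) = #_w s − #_{−w} s`,
**`o(y) − o(y + 3n) = o(y + 2n) − o(y + 2n + 3n)`** — and hence (apply it again at `y + 2n`) also
`= o(y + 4n) − o(y + 4n + 3n)`: the three diameters `{w, w + m/2}` of the hexagon `y + (m/6)ℤ` carry the same difference of
odd parts. This formalisation's lemma (`countSub_class_twoThreePower` at `y′ = y + 2n`).
[cite: Deligne1982HodgeCycles, Rem. 7.16 (a)] [cite: Aoki1983, Prop. 2.2] -/
theorem countSub_hexagon_twoThreePower (hm : m = 6 * n) (hn : n = 2 ^ i * 3 ^ k) (hi : 1 ≤ i) (hk : 1 ≤ k)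
    {s : Multiset (ZMod m)} (hs : IsHodgeMultiset s) {y : ZMod m} (hy : ¬ 2 ∣ y.val) (hy3 : ¬ 3 ∣ y.val) :
    ((count y s : ℤ) - count (-y) s) - ((count (y + 𝔥) s : ℤ) - count (-(y + 𝔥)) s) =
      ((count (y + 𝔯) s : ℤ) - count (-(y + 𝔯)) s) - ((count (y + 𝔯 + 𝔥) s : ℤ) - count (-(y + 𝔯 + 𝔥)) s) := by
  obtain ⟨h1, h2, h3⟩ := add_r_class hm (n_pos hn) (three_dvd_n hn hk) hy hy3
  exact countSub_class_twoThreePower hm hn hi hs hy hy3 h1 h2 h3.symm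

/-! ### The hexagon in the normal form `y + j·n`, `j = 0, …, 5` -/

omit [NeZero m] in
/-- `3n = 3·n`, `2n = 2·n` as residues. [folklore] -/
private theorem h_eq_three_mul : (𝔥 : ZMod m) = 3 * 𝔫 ∧ (𝔯 : ZMod m) = 2 * 𝔫 := by
  constructor <;> push_cast <;> ring

omit [NeZero m] in
/-- `6·n = 0` in `ℤ/6n`. [folklore] -/
private theorem six_mul_n (hm : m = 6 * n) : (6 : ZMod m) * 𝔫 = 0 := by
  have e : (6 : ZMod m) * ((n : ℕ) : ZMod m) = ((m : ℕ) : ZMod m) := by rw [hm]; push_cast; ring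
  rw [e, ZMod.natCast_self]

/-- **The hexagon relation, normal form.** For a Hodge multiset `s` over `ℤ/6n` (`n = 2ⁱ3ᵏ`, `i, k ≥ 1`) and a unit `y`, with
`o(w) = #_w s − #_{−w} s`: `o(y) − o(y + 3n) = o(y + 2n) − o(y + 5n)` and `o(y + 2n) − o(y + 5n) = o(y + 4n) − o(y + n)`.
[cite: Deligne1982HodgeCycles, Rem. 7.16 (a)] [cite: Aoki1983, Prop. 2.2] -/
theorem countSub_hexagon_twoThreePower' (hm : m = 6 * n) (hn : n = 2 ^ i * 3 ^ k) (hi : 1 ≤ i) (hk : 1 ≤ k)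
    {s : Multiset (ZMod m)} (hs : IsHodgeMultiset s) {y : ZMod m} (hy : ¬ 2 ∣ y.val) (hy3 : ¬ 3 ∣ y.val) :
    (((count y s : ℤ) - count (-y) s) - ((count (y + 3 * 𝔫) s : ℤ) - count (-(y + 3 * 𝔫)) s) =
      ((count (y + 2 * 𝔫) s : ℤ) - count (-(y + 2 * 𝔫)) s) - ((count (y + 5 * 𝔫) s : ℤ) - count (-(y + 5 * 𝔫)) s)) ∧
    (((count (y + 2 * 𝔫) s : ℤ) - count (-(y + 2 * 𝔫)) s) - ((count (y + 5 * 𝔫) s : ℤ) - count (-(y + 5 * 𝔫)) s) =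
      ((count (y + 4 * 𝔫) s : ℤ) - count (-(y + 4 * 𝔫)) s) - ((count (y + 𝔫) s : ℤ) - count (-(y + 𝔫)) s)) := by
  obtain ⟨eh, er⟩ := h_eq_three_mul (m := m) (n := n)
  have h6 := six_mul_n hm
  obtain ⟨h1, h2, -⟩ := add_r_class hm (n_pos hn) (three_dvd_n hn hk) hy hy3
  have E1 := countSub_hexagon_twoThreePower hm hn hi hk hs hy hy3
  have E2 := countSub_hexagon_twoThreePower hm hn hi hk hs h1 h2
  have e2 : y + 𝔯 = y + 2 * 𝔫 := by rw [er]
  have e3 : y + 𝔥 = y + 3 * 𝔫 := by rw [eh]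
  have e5 : y + 𝔯 + 𝔥 = y + 5 * 𝔫 := by rw [er, eh]; ring
  have e4 : y + 𝔯 + 𝔯 = y + 4 * 𝔫 := by rw [er]; ring
  have e7 : y + 𝔯 + 𝔯 + 𝔥 = y + 𝔫 := by rw [er, eh]; linear_combination h6
  rw [e5, e3, e2] at E1
  rw [e7, e5, e4, e2] at E2
  exact ⟨E1, E2⟩

/-! ### Twelve points in general position: `±(y + j·n)`, `j = 0, …, 5` -/

omit [NeZero m] in
/-- `j·n` as a residue: `⟨j·n⟩ = j·n` for `j < 6`. [folklore] -/
private theorem val_natCast_mul_n (hm : m = 6 * n) (hn0 : 0 < n) {j : ℕ} (hj : j < 6) :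
    (((j : ℕ) : ZMod m) * 𝔫).val = j * n := by
  rw [show ((j : ℕ) : ZMod m) * 𝔫 = ((j * n : ℕ) : ZMod m) by push_cast; ring, ZMod.val_natCast,
    Nat.mod_eq_of_lt (by rw [hm]; nlinarith)]

omit [NeZero m] in
/-- `j·n = l·n` with `j, l < 6` forces `j = l` (`n > 0`). [folklore] -/
private theorem natCast_mul_n_inj (hm : m = 6 * n) (hn0 : 0 < n) {j l : ℕ} (hj : j < 6) (hl : l < 6)
    (h : ((j : ℕ) : ZMod m) * 𝔫 = ((l : ℕ) : ZMod m) * 𝔫) : j = l := by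
  have hv := congrArg ZMod.val h
  rw [val_natCast_mul_n hm hn0 hj, val_natCast_mul_n hm hn0 hl] at hv
  exact Nat.eq_of_mul_eq_mul_right hn0 hv

omit [NeZero m] in
/-- `3 ∣ ⟨j·n⟩` when `3 ∣ n`. [folklore] -/
private theorem three_dvd_val_mul_n (hm : m = 6 * n) (h3 : 3 ∣ n) (j : ℕ) : 3 ∣ (((j : ℕ) : ZMod m) * 𝔫).val := by
  rw [show ((j : ℕ) : ZMod m) * 𝔫 = ((j * n : ℕ) : ZMod m) by push_cast; ring, ZMod.val_natCast]
  exact (Nat.dvd_mod_iff (three_dvd_m hm)).mpr (Dvd.dvd.mul_left h3 j)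

/-- **`2y + j·n ≠ 0`** for `y` prime to `3` (`3 ∣ n`): reduce modulo `3`. [folklore] -/
private theorem two_mul_add_ne_zero (hm : m = 6 * n) (h3 : 3 ∣ n) {y : ZMod m} (hy3 : ¬ 3 ∣ y.val) (j : ℕ) :
    2 * y + ((j : ℕ) : ZMod m) * 𝔫 ≠ 0 := by
  intro h
  have h3m := three_dvd_m hm
  set ρ := ZMod.castHom h3m (ZMod 3) with hρ
  have hn3 : ρ (((j : ℕ) : ZMod m) * 𝔫) = 0 := (dvd_val_iff_cast h3m _).mp (three_dvd_val_mul_n hm h3 j)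
  have hy' : ρ y ≠ 0 := fun e ↦ hy3 ((dvd_val_iff_cast h3m y).mpr e)
  have e := congrArg ρ h
  rw [_root_.map_add, _root_.map_mul, hn3, add_zero, map_ofNat, _root_.map_zero] at e
  have key : ∀ x : ZMod 3, 2 * x = 0 → x = 0 := by decide
  exact hy' (key _ e)

variable (n) in
/-- The twelve points `±(y + j·n)`, `j = 0, …, 5`, indexed by `Fin 2 × Fin 6`. [folklore] -/
private def pt (y : ZMod m) (e : Fin 2 × Fin 6) : ZMod m :=
  if e.1 = 0 then y + ((e.2 : ℕ) : ZMod m) * 𝔫 else -(y + ((e.2 : ℕ) : ZMod m) * 𝔫)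

/-- **The twelve points `±(y + j·n)` are pairwise distinct** (`y` prime to `3`, `3 ∣ n`): equal signs differ by `(j − l)·n ≠ 0`,
opposite signs would give `2y + (j + l)·n = 0`, impossible modulo `3`. [folklore] -/
private theorem pt_injective (hm : m = 6 * n) (hn0 : 0 < n) (h3 : 3 ∣ n) {y : ZMod m} (hy3 : ¬ 3 ∣ y.val) :
    Function.Injective (pt n y) := by
  rintro ⟨e, j⟩ ⟨e', l⟩ h
  have hj := j.isLt
  have hl := l.isLt
  -- same sign: `j = l`
  have same : y + ((j : ℕ) : ZMod m) * 𝔫 = y + ((l : ℕ) : ZMod m) * 𝔫 → j = l := fun e ↦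
    Fin.ext (natCast_mul_n_inj hm hn0 hj hl (add_left_cancel e))
  -- opposite signs: impossible
  have opp : y + ((j : ℕ) : ZMod m) * 𝔫 ≠ -(y + ((l : ℕ) : ZMod m) * 𝔫) := by
    intro e2
    apply two_mul_add_ne_zero hm h3 hy3 (j + l)
    push_cast
    linear_combination e2
  have opp' : -(y + ((j : ℕ) : ZMod m) * 𝔫) ≠ y + ((l : ℕ) : ZMod m) * 𝔫 := by
    intro e2
    apply two_mul_add_ne_zero hm h3 hy3 (l + j)
    push_cast
    linear_combination -e2
  fin_cases e <;> fin_cases e'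
  · simp only [pt, Fin.zero_eta, Fin.isValue, ↓reduceIte] at h
    rw [same h]
  · simp only [pt, Fin.zero_eta, Fin.isValue, ↓reduceIte, Fin.mk_one, one_ne_zero] at h
    exact absurd h opp
  · simp only [pt, Fin.mk_one, Fin.isValue, one_ne_zero, ↓reduceIte, Fin.zero_eta] at h
    exact absurd h opp'
  · simp only [pt, Fin.mk_one, Fin.isValue, one_ne_zero, ↓reduceIte, neg_inj] at h
    rw [same h]

omit [NeZero m] in
/-- The counts of a multiset over any finite set of points add up to at most its cardinality. [folklore] -/
private theorem sum_count_le_card (F : Finset (ZMod m)) (s : Multiset (ZMod m)) : ∑ a ∈ F, count a s ≤ card s := by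
  classical
  calc ∑ a ∈ F, count a s ≤ ∑ a ∈ F ∪ s.toFinset, count a s :=
        Finset.sum_le_sum_of_subset Finset.subset_union_left
    _ = card s := Multiset.sum_count_eq_card fun a ha ↦ Finset.mem_union_right _ (Multiset.mem_toFinset.mpr ha)

/-- **Mass bound.** The multiplicities of a multiset `s` at the twelve points `±(y + j·n)` add up to at most `#s`. [folklore] -/
private theorem mass_le (hm : m = 6 * n) (hn0 : 0 < n) (h3 : 3 ∣ n) {y : ZMod m} (hy3 : ¬ 3 ∣ y.val) (s : Multiset (ZMod m)) :
    count y s + count (-y) s + (count (y + 𝔫) s + count (-(y + 𝔫)) s) +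
      (count (y + 2 * 𝔫) s + count (-(y + 2 * 𝔫)) s) + (count (y + 3 * 𝔫) s + count (-(y + 3 * 𝔫)) s) +
      (count (y + 4 * 𝔫) s + count (-(y + 4 * 𝔫)) s) + (count (y + 5 * 𝔫) s + count (-(y + 5 * 𝔫)) s) ≤ card s := by
  classical
  have key := sum_count_le_card (Finset.univ.map ⟨pt n y, pt_injective hm hn0 h3 hy3⟩) s
  rw [Finset.sum_map, Fintype.sum_prod_type, Fin.sum_univ_two, Fin.sum_univ_six, Fin.sum_univ_six] at key
  simp only [Function.Embedding.coeFn_mk, pt, Fin.isValue, ↓reduceIte, one_ne_zero, Fin.val_zero, Nat.cast_zero,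
    zero_mul, add_zero, Fin.val_one, Nat.cast_one, one_mul, Fin.val_two, Nat.cast_ofNat] at key
  have e3 : ((3 : Fin 6) : ℕ) = 3 := rfl
  have e4 : ((4 : Fin 6) : ℕ) = 4 := rfl
  have e5 : ((5 : Fin 6) : ℕ) = 5 := rfl
  simp only [e3, e4, e5, Nat.cast_ofNat] at key
  omega

/-! ### Pair-free multisets -/

omit [NeZero m] in
/-- In a pair-free multiset, a member `w ≠ −w` excludes `−w`. [cite: Shioda1982PicardFermat, §2 p. 726] -/
private theorem count_neg_eq_zero_of_not_hasPair {s : Multiset (ZMod m)} (hpf : ¬ HasPair s) {w : ZMod m} (hw : w ≠ -w)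
    (hws : 0 < count w s) : count (-w) s = 0 := by
  by_contra h
  apply hpf
  refine ⟨w, Multiset.count_pos.mp hws, ?_⟩
  rw [← Multiset.count_pos, Multiset.count_erase_of_ne hw.symm]
  exact Nat.pos_of_ne_zero h

omit [NeZero m] in
/-- In a pair-free multiset, for `w ≠ −w` one of `#_w`, `#_{−w}` vanishes. [folklore] -/
private theorem count_or_count_neg_eq_zero {s : Multiset (ZMod m)} (hpf : ¬ HasPair s) {w : ZMod m} (hw : w ≠ -w) :
    count w s = 0 ∨ count (-w) s = 0 := by
  by_cases h : count w s = 0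
  · exact Or.inl h
  · exact Or.inr (count_neg_eq_zero_of_not_hasPair hpf hw (Nat.pos_of_ne_zero h))

/-- `w ≠ −w` for `w = y + j·n` with `y` prime to `3` (`2w = 2y + 2j·n ≠ 0`). [folklore] -/
private theorem ne_neg_of_unit (hm : m = 6 * n) (h3 : 3 ∣ n) {y : ZMod m} (hy3 : ¬ 3 ∣ y.val) (j : ℕ) :
    y + ((j : ℕ) : ZMod m) * 𝔫 ≠ -(y + ((j : ℕ) : ZMod m) * 𝔫) := by
  intro e
  apply two_mul_add_ne_zero hm h3 hy3 (j + j)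
  push_cast
  linear_combination e

omit [NeZero m] in
/-- Three distinct members of a `4`-multiset leave one more member. [folklore] -/
private theorem exists_eq_of_three_mem {s : Multiset (ZMod m)} (hcard : card s = 4) {a b c : ZMod m}
    (ha : a ∈ s) (hb : b ∈ s) (hc : c ∈ s) (hab : a ≠ b) (hac : a ≠ c) (hbc : b ≠ c) :
    ∃ t, s = a ::ₘ b ::ₘ c ::ₘ {t} := by
  have h1 : s = a ::ₘ s.erase a := (Multiset.cons_erase ha).symm
  have hb' : b ∈ s.erase a := (Multiset.mem_erase_of_ne hab.symm).mpr hb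
  have h2 : s.erase a = b ::ₘ (s.erase a).erase b := (Multiset.cons_erase hb').symm
  have hc' : c ∈ (s.erase a).erase b :=
    (Multiset.mem_erase_of_ne hbc.symm).mpr ((Multiset.mem_erase_of_ne hac.symm).mpr hc)
  have h3 : (s.erase a).erase b = c ::ₘ ((s.erase a).erase b).erase c := (Multiset.cons_erase hc').symm
  have hcard' : card (((s.erase a).erase b).erase c) = 1 := by
    rw [Multiset.card_erase_of_mem hc', Multiset.card_erase_of_mem hb', Multiset.card_erase_of_mem ha, hcard]
    rfl
  obtain ⟨t, ht⟩ := Multiset.card_eq_one.mp hcard'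
  exact ⟨t, by rw [h1, h2, h3, ht]⟩

omit [NeZero m] in
/-- The sum of `{a, b, c, t}`. [folklore] -/
private theorem sum_four (a b c t : ZMod m) : (a ::ₘ b ::ₘ c ::ₘ ({t} : Multiset (ZMod m))).sum = a + b + c + t := by
  simp only [Multiset.sum_cons, Multiset.sum_singleton]
  ring

omit [NeZero m] in
/-- In `{a, b, c, c}` the member `c` occurs at least twice. [folklore] -/
private theorem two_le_count_four₃ (a b c : ZMod m) : 2 ≤ count c (a ::ₘ b ::ₘ c ::ₘ ({c} : Multiset (ZMod m))) := by
  classical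
  have h : c ::ₘ ({c} : Multiset (ZMod m)) ≤ a ::ₘ b ::ₘ c ::ₘ ({c} : Multiset (ZMod m)) :=
    (Multiset.le_cons_self _ _).trans (Multiset.le_cons_self _ _)
  calc 2 = count c (c ::ₘ ({c} : Multiset (ZMod m))) := by simp
    _ ≤ _ := Multiset.count_le_of_le _ h

omit [NeZero m] in
/-- In `{a, b, c, b}` the member `b` occurs at least twice. [folklore] -/
private theorem two_le_count_four₂ (a b c : ZMod m) : 2 ≤ count b (a ::ₘ b ::ₘ c ::ₘ ({b} : Multiset (ZMod m))) := by
  classical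
  have h : b ::ₘ ({b} : Multiset (ZMod m)) ≤ a ::ₘ b ::ₘ c ::ₘ ({b} : Multiset (ZMod m)) :=
    (Multiset.cons_le_cons b (Multiset.le_cons_self _ c)).trans (Multiset.le_cons_self _ a)
  calc 2 = count b (b ::ₘ ({b} : Multiset (ZMod m))) := by simp
    _ ≤ _ := Multiset.count_le_of_le _ h

omit [NeZero m] in
/-- In `{a, b, c, a}` the member `a` occurs at least twice. [folklore] -/
private theorem two_le_count_four₁ (a b c : ZMod m) : 2 ≤ count a (a ::ₘ b ::ₘ c ::ₘ ({a} : Multiset (ZMod m))) := by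
  classical
  have h : a ::ₘ ({a} : Multiset (ZMod m)) ≤ a ::ₘ b ::ₘ c ::ₘ ({a} : Multiset (ZMod m)) :=
    Multiset.cons_le_cons a ((Multiset.le_cons_self _ c).trans (Multiset.le_cons_self _ b))
  calc 2 = count a (a ::ₘ ({a} : Multiset (ZMod m))) := by simp
    _ ≤ _ := Multiset.count_le_of_le _ h

/-! ### Twin or `γ`: the dichotomy for a unit member of an indecomposable Hodge quadruple -/

/-- The arithmetic of the twelve multiplicities (`c_j = #_{y + jn}`, `c'_j = #_{−(y + jn)}`): the two hexagon identities, the mass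
bound, `c₀ ≥ 1`, `c'₀ = 0` and pair-freeness leave the twin (`c₃ = c₀`) or `c₀ = 1` with one member in each of
`{y + 2n, −(y + 5n)}`, `{y + 4n, −(y + n)}`. [folklore] -/
private theorem shape_arith {c0 c0' c1 c1' c2 c2' c3 c3' c4 c4' c5 c5' : ℕ}
    (E1 : ((c0 : ℤ) - c0') - ((c3 : ℤ) - c3') = ((c2 : ℤ) - c2') - ((c5 : ℤ) - c5'))
    (E2 : ((c2 : ℤ) - c2') - ((c5 : ℤ) - c5') = ((c4 : ℤ) - c4') - ((c1 : ℤ) - c1'))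
    (M : c0 + c0' + (c1 + c1') + (c2 + c2') + (c3 + c3') + (c4 + c4') + (c5 + c5') ≤ 4)
    (a1 : 1 ≤ c0) (n0 : c0' = 0) (n3 : c3 = 0 ∨ c3' = 0) (n4 : c4 = 0 ∨ c4' = 0) (n5 : c5 = 0 ∨ c5' = 0) :
    c3 = c0 ∨ (c0 = 1 ∧ c2 = 1 ∧ c4 = 1) ∨ (c0 = 1 ∧ c2 = 1 ∧ c1' = 1) ∨ (c0 = 1 ∧ c5' = 1 ∧ c4 = 1) ∨
      (c0 = 1 ∧ c5' = 1 ∧ c1' = 1) := by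
  omega

/-- **Twin or `γ`.** Let `m = 6n = 2ᵃ3ᵇ` with `a, b ≥ 2` (`n = 2ⁱ3ᵏ`, `i, k ≥ 1`), and let `s` be a PAIR-FREE Hodge multiset over
`ℤ/m` with four members (an indecomposable element of `𝔅²ₘ` up to order, [Shioda1982PicardFermat, §2]). Then every unit
member `y ∈ s` is either TWINNED — `#_{y + m/2} s = #_y s` — or `s = γ_y = {y, y + m/3, y + 2m/3, −3y}` (Shioda's standard element
of type `c)`, [Shioda1982PicardFermat, Lemma 1 (b)] / [AokiShioda1983, Thm. (𝔅²ₘ) (ii) c)]). PROOF (this formalisation's): the two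
hexagon identities `o(y) − o(y+3n) = o(y+2n) − o(y+5n) = o(y+4n) − o(y+n)`, the mass bound over the twelve distinct points
`±(y + jn)`, pair-freeness (`#_w · #_{−w} = 0` there) and `#_y ≥ 1`, `#_{−y} = 0` leave, besides the twin, only `#_y = 1` with one
member in each of `{y + 2n, −(y + 5n)}`, `{y + 4n, −(y + n)}`; the zero sum then identifies the fourth member: `{y + 2n, y + 4n}`
gives `−3y` (the `γ`), the three other choices reproduce a member already counted once — a contradiction. Towards
[Aoki1983, Thm. C] at the levels `2ᵃ3ᵇ` (part I). [cite: Aoki1983, Thm. C] [cite: Shioda1982PicardFermat, Lemma 1 (b), Prop. 4 (Q′)] -/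
theorem twin_or_gamma_twoThreePower (hm : m = 6 * n) (hn : n = 2 ^ i * 3 ^ k) (hi : 1 ≤ i) (hk : 1 ≤ k)
    {s : Multiset (ZMod m)} (hs : IsHodgeMultiset s) (hcard : card s = 4) (hpf : ¬ HasPair s) {y : ZMod m} (hy : y ∈ s)
    (hy2 : ¬ 2 ∣ y.val) (hy3 : ¬ 3 ∣ y.val) :
    count (y + 3 * 𝔫) s = count y s ∨ s = y ::ₘ (y + 2 * 𝔫) ::ₘ (y + 4 * 𝔫) ::ₘ {-(3 * y)} := by
  classical
  have hn0 : 0 < n := n_pos hn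
  have h3 : 3 ∣ n := three_dvd_n hn hk
  have h6 := six_mul_n hm
  obtain ⟨E1, E2⟩ := countSub_hexagon_twoThreePower' hm hn hi hk hs hy2 hy3
  have M := mass_le hm hn0 h3 hy3 s
  rw [hcard] at M
  have a1 : 1 ≤ count y s := Multiset.one_le_count_iff_mem.mpr hy
  -- the points `±(y + j n)` as values of `pt`, for distinctness
  have inj := pt_injective hm hn0 h3 hy3
  -- pair-freeness at the six diameters
  have nn : ∀ j : ℕ, count (y + ((j : ℕ) : ZMod m) * 𝔫) s = 0 ∨ count (-(y + ((j : ℕ) : ZMod m) * 𝔫)) s = 0 :=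
    fun j ↦ count_or_count_neg_eq_zero hpf (ne_neg_of_unit hm h3 hy3 j)
  have n0 : count (-y) s = 0 :=
    count_neg_eq_zero_of_not_hasPair hpf (w := y) (by simpa using ne_neg_of_unit hm h3 hy3 0) a1
  have n3 := nn 3
  have n4 := nn 4
  have n5 := nn 5
  simp only [Nat.cast_ofNat] at n3 n4 n5
  -- the arithmetic: twin, `γ`, or one of three dead configurations
  have shape : count (y + 3 * 𝔫) s = count y s ∨
      (count y s = 1 ∧ count (y + 2 * 𝔫) s = 1 ∧ count (y + 4 * 𝔫) s = 1) ∨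
      (count y s = 1 ∧ count (y + 2 * 𝔫) s = 1 ∧ count (-(y + 𝔫)) s = 1) ∨
      (count y s = 1 ∧ count (-(y + 5 * 𝔫)) s = 1 ∧ count (y + 4 * 𝔫) s = 1) ∨
      (count y s = 1 ∧ count (-(y + 5 * 𝔫)) s = 1 ∧ count (-(y + 𝔫)) s = 1) :=
    shape_arith E1 E2 M a1 n0 n3 n4 n5
  -- names of the points as values of `pt`
  have p0 : y = pt n y (0, 0) := by simp [pt]
  have p2 : y + 2 * 𝔫 = pt n y (0, 2) := by simp [pt]
  have p4 : y + 4 * 𝔫 = pt n y (0, 4) := by simp [pt]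
  have q1 : -(y + 𝔫) = pt n y (1, 1) := by simp [pt]
  have q5 : -(y + 5 * 𝔫) = pt n y (1, 5) := by simp [pt]
  -- distinctness of named points through the injectivity of `pt`
  have D : ∀ e e' : Fin 2 × Fin 6, e ≠ e' → ∀ {A B : ZMod m}, A = pt n y e → B = pt n y e' → A ≠ B :=
    fun e e' h A B hA hB hAB ↦ h (inj (by rw [← hA, ← hB, hAB]))
  have hsum : s.sum = 0 := hs.1.2
  rcases shape with h | ⟨c0, c2, c4⟩ | ⟨c0, c2, c1⟩ | ⟨c0, c5, c4⟩ | ⟨c0, c5, c1⟩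
  · exact Or.inl h
  · -- `γ_y`
    right
    obtain ⟨t, ht⟩ := exists_eq_of_three_mem hcard hy (Multiset.count_pos.mp (by rw [c2]; exact Nat.one_pos))
      (Multiset.count_pos.mp (by rw [c4]; exact Nat.one_pos)) (D _ _ (by decide) p0 p2)
      (D _ _ (by decide) p0 p4) (D _ _ (by decide) p2 p4)
    have htsum := hsum
    rw [ht, sum_four] at htsum
    have htt : t = -(3 * y) := by linear_combination htsum - h6
    rw [ht, htt]
  · exfalso
    obtain ⟨t, ht⟩ := exists_eq_of_three_mem hcard hy (Multiset.count_pos.mp (by rw [c2]; exact Nat.one_pos))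
      (Multiset.count_pos.mp (by rw [c1]; exact Nat.one_pos)) (D _ _ (by decide) p0 p2)
      (D _ _ (by decide) p0 q1) (D _ _ (by decide) p2 q1)
    have htsum := hsum
    rw [ht, sum_four] at htsum
    have htt : t = -(y + 𝔫) := by linear_combination htsum
    rw [htt] at ht
    rw [ht] at c1
    have two := two_le_count_four₃ y (y + 2 * 𝔫) (-(y + 𝔫))
    omega
  · exfalso
    obtain ⟨t, ht⟩ := exists_eq_of_three_mem hcard hy (Multiset.count_pos.mp (by rw [c5]; exact Nat.one_pos))
      (Multiset.count_pos.mp (by rw [c4]; exact Nat.one_pos)) (D _ _ (by decide) p0 q5)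
      (D _ _ (by decide) p0 p4) (D _ _ (by decide) q5 p4)
    have htsum := hsum
    rw [ht, sum_four] at htsum
    have htt : t = -(y + 5 * 𝔫) := by linear_combination htsum + h6
    rw [htt] at ht
    rw [ht] at c5
    have two := two_le_count_four₂ y (-(y + 5 * 𝔫)) (y + 4 * 𝔫)
    omega
  · exfalso
    obtain ⟨t, ht⟩ := exists_eq_of_three_mem hcard hy (Multiset.count_pos.mp (by rw [c5]; exact Nat.one_pos))
      (Multiset.count_pos.mp (by rw [c1]; exact Nat.one_pos)) (D _ _ (by decide) p0 q5)
      (D _ _ (by decide) p0 q1) (D _ _ (by decide) q5 q1)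
    have htsum := hsum
    rw [ht, sum_four] at htsum
    have htt : t = y := by linear_combination htsum + h6
    rw [htt] at ht
    rw [ht] at c0
    have two := two_le_count_four₁ y (-(y + 5 * 𝔫)) (-(y + 𝔫))
    omega

/-! ### The shape of a twinned quadruple: `{y, y + 3n, z, w}` with `z, w` even, not both divisible by `3` -/

/-- `c·y + j·n ≠ 0` for `y` prime to `3`, `3 ∤ c` (`3 ∣ n`): reduce modulo `3`. [folklore] -/
private theorem natMul_add_ne_zero (hm : m = 6 * n) (h3 : 3 ∣ n) {y : ZMod m} (hy3 : ¬ 3 ∣ y.val) {c : ℕ} (hc : ¬ 3 ∣ c)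
    (j : ℕ) : (c : ZMod m) * y + ((j : ℕ) : ZMod m) * 𝔫 ≠ 0 := by
  intro h
  have h3m := three_dvd_m hm
  set ρ := ZMod.castHom h3m (ZMod 3) with hρ
  have hn3 : ρ (((j : ℕ) : ZMod m) * 𝔫) = 0 := (dvd_val_iff_cast h3m _).mp (three_dvd_val_mul_n hm h3 j)
  have hy' : ρ y ≠ 0 := fun e ↦ hy3 ((dvd_val_iff_cast h3m y).mpr e)
  have hc' : ((c : ℕ) : ZMod 3) ≠ 0 := by rwa [Ne, ZMod.natCast_eq_zero_iff]
  have e := congrArg ρ h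
  rw [_root_.map_add, _root_.map_mul, hn3, add_zero, map_natCast, _root_.map_zero] at e
  have key : ∀ a x : ZMod 3, a ≠ 0 → a * x = 0 → x = 0 := by decide
  exact hy' (key _ _ hc' e)

omit [NeZero m] in
/-- `y + j·n ≠ y + l·n` for `j ≠ l` below `6`. [folklore] -/
private theorem add_mul_n_ne (hm : m = 6 * n) (hn0 : 0 < n) (y : ZMod m) {j l : ℕ} (hj : j < 6) (hl : l < 6) (hjl : j ≠ l) :
    y + ((j : ℕ) : ZMod m) * 𝔫 ≠ y + ((l : ℕ) : ZMod m) * 𝔫 :=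
  fun e ↦ hjl (natCast_mul_n_inj hm hn0 hj hl (add_left_cancel e))

/-- `y + j·n ≠ −(y + l·n)` for `y` prime to `3`. [folklore] -/
private theorem add_mul_n_ne_neg (hm : m = 6 * n) (h3 : 3 ∣ n) {y : ZMod m} (hy3 : ¬ 3 ∣ y.val) (j l : ℕ) :
    y + ((j : ℕ) : ZMod m) * 𝔫 ≠ -(y + ((l : ℕ) : ZMod m) * 𝔫) := by
  intro e
  apply two_mul_add_ne_zero hm h3 hy3 (j + l)
  push_cast
  linear_combination e

/-- `2x = 0` in `ℤ/6n` forces `x ∈ {0, 3n}`. [folklore] -/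
private theorem eq_zero_or_eq_h_of_two_mul (hm : m = 6 * n) (hn0 : 0 < n) {x : ZMod m} (h : (2 : ZMod m) * x = 0) :
    x = 0 ∨ x = 𝔥 := by
  have hv : (2 * x.val) % m = 0 := by
    have := congrArg ZMod.val h
    rw [ZMod.val_mul, ZMod.val_zero, show ((2 : ZMod m)).val = 2 by
      rw [show (2 : ZMod m) = ((2 : ℕ) : ZMod m) by norm_cast, ZMod.val_natCast, Nat.mod_eq_of_lt (by omega)]] at this
    exact this
  have hx := ZMod.val_lt x
  by_cases hlt : 2 * x.val < m
  · left
    rw [Nat.mod_eq_of_lt hlt] at hv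
    apply ZMod.val_injective m
    rw [ZMod.val_zero]
    omega
  · right
    apply ZMod.val_injective m
    rw [val_h hm hn0]
    rw [Nat.mod_eq_sub_mod (by omega), Nat.mod_eq_of_lt (by omega)] at hv
    omega

omit [NeZero m] in
/-- Two distinct members of a `4`-multiset leave two more members. [folklore] -/
private theorem exists_eq_of_two_mem {s : Multiset (ZMod m)} (hcard : card s = 4) {a b : ZMod m} (ha : a ∈ s) (hb : b ∈ s)
    (hab : a ≠ b) : ∃ z w, s = a ::ₘ b ::ₘ {z, w} := by
  have h1 : s = a ::ₘ s.erase a := (Multiset.cons_erase ha).symm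
  have hb' : b ∈ s.erase a := (Multiset.mem_erase_of_ne hab.symm).mpr hb
  have h2 : s.erase a = b ::ₘ (s.erase a).erase b := (Multiset.cons_erase hb').symm
  have hcard' : card ((s.erase a).erase b) = 2 := by
    rw [Multiset.card_erase_of_mem hb', Multiset.card_erase_of_mem ha, hcard]
    rfl
  obtain ⟨z, w, hzw⟩ := Multiset.card_eq_two.mp hcard'
  exact ⟨z, w, by rw [h1, h2, hzw]⟩

omit [NeZero m] in
/-- The sum of `{a, b, z, w}`. [folklore] -/
private theorem sum_four' (a b z w : ZMod m) : (a ::ₘ b ::ₘ ({z, w} : Multiset (ZMod m))).sum = a + b + (z + w) := by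
  simp only [Multiset.sum_cons, Multiset.insert_eq_cons, Multiset.sum_singleton]
  ring

/-- **A twinned unit member occurs once.** In a pair-free Hodge `4`-multiset over `ℤ/2ᵃ3ᵇ` (`a, b ≥ 2`) a unit member `y` with
`#_{y+3n} = #_y` has `#_y = 1`: otherwise `s = {y, y, y + 3n, y + 3n}` and the zero sum gives `4y = 0`. [folklore] -/
private theorem count_eq_one_of_twin (hm : m = 6 * n) (hn : n = 2 ^ i * 3 ^ k) (hk : 1 ≤ k) {s : Multiset (ZMod m)}
    (hs : IsHodgeMultiset s) (hcard : card s = 4) {y : ZMod m} (hy : y ∈ s) (hy3 : ¬ 3 ∣ y.val)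
    (htwin : count (y + 3 * 𝔫) s = count y s) : count y s = 1 := by
  classical
  have hn0 := n_pos hn
  have h3 := three_dvd_n hn hk
  have a1 : 1 ≤ count y s := Multiset.one_le_count_iff_mem.mpr hy
  by_contra hne
  have a2 : 2 ≤ count y s := by omega
  have hyB : y ≠ y + 3 * 𝔫 := by simpa using add_mul_n_ne hm hn0 y (j := 0) (l := 3) (by omega) (by omega) (by omega)
  -- `{y, y, y+3n, y+3n} ≤ s`, hence `= s`
  set T : Multiset (ZMod m) := y ::ₘ y ::ₘ (y + 3 * 𝔫) ::ₘ {y + 3 * 𝔫} with hT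
  have hle : T ≤ s := by
    rw [Multiset.le_iff_count]
    intro a
    by_cases hay : a = y
    · subst hay
      have : count a T = 2 := by
        simp only [hT, Multiset.count_cons_self, Multiset.count_cons_of_ne hyB, Multiset.count_singleton, if_neg hyB]
      omega
    · by_cases haB : a = y + 3 * 𝔫
      · subst haB
        have : count (y + 3 * 𝔫) T = 2 := by
          simp only [hT, Multiset.count_cons_of_ne (Ne.symm hyB), Multiset.count_cons_self, Multiset.count_singleton_self]
        omega
      · have : count a T = 0 := by
          simp only [hT, Multiset.count_cons_of_ne hay, Multiset.count_cons_of_ne haB, Multiset.count_singleton, if_neg haB]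
        omega
  have hTs : T = s := Multiset.eq_of_le_of_card_le hle (by rw [hcard, hT]; simp)
  have hsum : s.sum = 0 := hs.1.2
  rw [← hTs, hT] at hsum
  simp only [Multiset.sum_cons, Multiset.sum_singleton] at hsum
  apply natMul_add_ne_zero hm h3 hy3 (c := 4) (by omega) 6
  push_cast
  linear_combination hsum

/-- `3 ∣ ⟨−3z⟩`. [folklore] -/
private theorem three_dvd_val_neg_three_mul (hm : m = 6 * n) (z : ZMod m) : 3 ∣ (-(3 * z)).val := by
  rw [dvd_val_neg_iff (three_dvd_m hm)]
  rw [show (3 : ZMod m) * z = ((3 * z.val : ℕ) : ZMod m) by push_cast; rw [ZMod.natCast_zmod_val], ZMod.val_natCast]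
  exact (Nat.dvd_mod_iff (three_dvd_m hm)).mpr (Dvd.intro _ rfl)

/-- A unit `y` and its twin `y + 3n` do not both lie in `γ_z = {z, z + 2n, z + 4n, −3z}` (`z` prime to `3`). [folklore] -/
private theorem not_twin_mem_gamma (hm : m = 6 * n) (hn0 : 0 < n) (h3 : 3 ∣ n) {y z : ZMod m} (hy3 : ¬ 3 ∣ y.val)
    (hz3 : ¬ 3 ∣ z.val) (hy : y ∈ (z ::ₘ (z + 2 * 𝔫) ::ₘ (z + 4 * 𝔫) ::ₘ {-(3 * z)} : Multiset (ZMod m)))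
    (hB : y + 3 * 𝔫 ∈ (z ::ₘ (z + 2 * 𝔫) ::ₘ (z + 4 * 𝔫) ::ₘ {-(3 * z)} : Multiset (ZMod m))) : False := by
  have h6 := six_mul_n hm
  simp only [Multiset.mem_cons, Multiset.mem_singleton] at hy hB
  -- the generic obstructions
  have A : ∀ j l : ℕ, j < 6 → l < 6 → j ≠ l → z + ((j : ℕ) : ZMod m) * 𝔫 ≠ z + ((l : ℕ) : ZMod m) * 𝔫 :=
    fun j l hj hl hjl ↦ add_mul_n_ne hm hn0 z hj hl hjl
  have B : ∀ j : ℕ, z + ((j : ℕ) : ZMod m) * 𝔫 ≠ -(3 * z) := fun j e ↦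
    natMul_add_ne_zero hm h3 hz3 (c := 4) (by omega) j (by push_cast; linear_combination e)
  have hy' : y ≠ -(3 * z) := fun e ↦ hy3 (by rw [e]; exact three_dvd_val_neg_three_mul hm z)
  -- `y = z + j n`, `j ∈ {0, 2, 4}`; then `y + 3n = z + (j+3) n`
  rcases hy with h0 | h2 | h4' | h4
  · rw [h0] at hB
    rcases hB with h | h | h | h
    · exact A 3 0 (by omega) (by omega) (by omega) (by simpa using h)
    · exact A 3 2 (by omega) (by omega) (by omega) (by simpa using h)
    · exact A 3 4 (by omega) (by omega) (by omega) (by simpa using h)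
    · exact B 3 (by simpa using h)
  · have e : z + 2 * 𝔫 + 3 * 𝔫 = z + ((5 : ℕ) : ZMod m) * 𝔫 := by push_cast; ring
    rw [h2, e] at hB
    rcases hB with h | h | h | h
    · exact A 5 0 (by omega) (by omega) (by omega) (by simpa using h)
    · exact A 5 2 (by omega) (by omega) (by omega) (by simpa using h)
    · exact A 5 4 (by omega) (by omega) (by omega) (by simpa using h)
    · exact B 5 h
  · have e : z + 4 * 𝔫 + 3 * 𝔫 = z + ((1 : ℕ) : ZMod m) * 𝔫 := by push_cast; linear_combination h6
    rw [h4', e] at hB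
    rcases hB with h | h | h | h
    · exact A 1 0 (by omega) (by omega) (by omega) (by simpa using h)
    · exact A 1 2 (by omega) (by omega) (by omega) (by simpa using h)
    · exact A 1 4 (by omega) (by omega) (by omega) (by simpa using h)
    · exact B 1 h
  · exact hy' h4

/-- In the twinned quadruple `s = {y, y + 3n, z, w}` (`#_y = #_{y+3n} = 1`), the member `z` is NOT a unit. [folklore] -/
private theorem not_unit_of_twin (hm : m = 6 * n) (hn : n = 2 ^ i * 3 ^ k) (hi : 1 ≤ i) (hk : 1 ≤ k)
    {s : Multiset (ZMod m)} (hs : IsHodgeMultiset s) (hcard : card s = 4) (hpf : ¬ HasPair s) {y z w : ZMod m}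
    (hy3 : ¬ 3 ∣ y.val) (hs4 : s = y ::ₘ (y + 3 * 𝔫) ::ₘ {z, w}) (hcy : count y s = 1)
    (hcB : count (y + 3 * 𝔫) s = 1) (hzw : z + w = -(2 * y + 3 * 𝔫)) : 2 ∣ z.val ∨ 3 ∣ z.val := by
  classical
  have hn0 := n_pos hn
  have h3 := three_dvd_n hn hk
  have h6 := six_mul_n hm
  by_cases hz2 : 2 ∣ z.val
  · exact Or.inl hz2
  by_cases hz3 : 3 ∣ z.val
  · exact Or.inr hz3
  exfalso
  have hz : z ∈ s := by rw [hs4]; simp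
  have hyB : y ≠ y + 3 * 𝔫 := by simpa using add_mul_n_ne hm hn0 y (j := 0) (l := 3) (by omega) (by omega) (by omega)
  rcases twin_or_gamma_twoThreePower hm hn hi hk hs hcard hpf hz hz2 hz3 with htw | hγ
  · -- `z` twinned: `z + 3n ∈ s = {y, y+3n, z, w}`
    have hz1 : 1 ≤ count z s := Multiset.one_le_count_iff_mem.mpr hz
    have hmem : z + 3 * 𝔫 ∈ s := Multiset.one_le_count_iff_mem.mp (by omega)
    rw [hs4] at hmem
    simp only [Multiset.mem_cons, Multiset.insert_eq_cons, Multiset.mem_singleton] at hmem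
    rcases hmem with h1 | h2 | h3' | h4
    · -- `z + 3n = y`: `z = y + 3n` occurs twice
      have hz' : z = y + 3 * 𝔫 := by linear_combination h1 - h6
      have : 2 ≤ count (y + 3 * 𝔫) s := by
        rw [hs4, Multiset.insert_eq_cons, ← hz', Multiset.count_cons_of_ne (Ne.symm (hz' ▸ hyB)),
          Multiset.count_cons_self, Multiset.count_cons_self]
        omega
      omega
    · -- `z + 3n = y + 3n`: `z = y` occurs twice
      have hz' : z = y := add_right_cancel h2
      have : 2 ≤ count y s := by
        rw [hs4, Multiset.insert_eq_cons, ← hz', Multiset.count_cons_self, Multiset.count_cons_of_ne (hz' ▸ hyB),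
          Multiset.count_cons_self]
        omega
      omega
    · -- `z + 3n = z`
      exact absurd (by simpa using h3') (by simpa using add_mul_n_ne hm hn0 z (j := 3) (l := 0) (by omega) (by omega) (by omega))
    · -- `z + 3n = w`: then `2(y + z) = 0`, a pair
      have h2yz : (2 : ZMod m) * (y + z) = 0 := by linear_combination hzw + h4 - h6
      rcases eq_zero_or_eq_h_of_two_mul hm hn0 h2yz with h0 | hh
      · -- `z = -y`
        have hzy : -y = z := by linear_combination -h0
        have hne : -y ≠ y := by
          rw [hzy]; rintro rfl
          exact absurd hzy.symm (by simpa using add_mul_n_ne_neg hm h3 hy3 0 0)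
        exact hpf ⟨y, by rw [hs4]; simp, (Multiset.mem_erase_of_ne hne).mpr (hzy ▸ hz)⟩
      · -- `z = -(y + 3n)`
        have hzy : -(y + 3 * 𝔫) = z := by
          have : (𝔥 : ZMod m) = 3 * 𝔫 := h_eq_three_mul.1
          linear_combination -hh - this - h6
        have hne : -(y + 3 * 𝔫) ≠ y + 3 * 𝔫 := by
          simpa using (add_mul_n_ne_neg hm h3 hy3 3 3).symm
        exact hpf ⟨y + 3 * 𝔫, by rw [hs4]; simp, (Multiset.mem_erase_of_ne hne).mpr (hzy ▸ hz)⟩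
  · -- `s = γ_z` contains `y` and `y + 3n`
    have hym : y ∈ s := Multiset.one_le_count_iff_mem.mp (by omega)
    have hBm : y + 3 * 𝔫 ∈ s := Multiset.one_le_count_iff_mem.mp (by omega)
    rw [hγ] at hym hBm
    exact not_twin_mem_gamma hm hn0 h3 hy3 hz3 hym hBm

/-- **The shape of a twinned quadruple.** Let `m = 6n = 2ᵃ3ᵇ` (`a, b ≥ 2`) and let `s` be a pair-free Hodge `4`-multiset over `ℤ/m`
with a unit member `y` that is twinned (`#_{y + 3n} = #_y`; by `twin_or_gamma_twoThreePower` the only alternative is `s = γ_y`). Then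
**`s = {y, y + 3n, z, w}` with `z + w = −(2y + 3n)`, `z, w` EVEN, and not both divisible by `3`** — the configuration that the
transfer to level `m/2` classifies (part II; cf. `PicardNumberTwoPowerPrime`, case of two odd members). PROOF: `#_y = 1` (else
`4y = 0`); a unit `z` would itself be twinned or a `γ` — twinned forces `z ∈ {y, y + 3n}` twice or a pair `z = −y`, `z = −(y+3n)`
(`2(y + z) = 0`), and `γ_z ∌ {y, y + 3n}`; so `z, w` are non-units, `z + w ≡ −2y ≢ 0 (mod 3)` forbids two multiples of `3`, and
`z + w ≡ 0 (mod 2)` with "odd non-unit ⇒ multiple of `3`" forbids odd members. This formalisation's lemma, towards [Aoki1983, Thm. C]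
at the levels `2ᵃ3ᵇ`. [cite: Aoki1983, Thm. C, §9 (III)] [cite: Shioda1982PicardFermat, Prop. 4 (Q′)] -/
theorem shape_of_twin_twoThreePower (hm : m = 6 * n) (hn : n = 2 ^ i * 3 ^ k) (hi : 1 ≤ i) (hk : 1 ≤ k)
    {s : Multiset (ZMod m)} (hs : IsHodgeMultiset s) (hcard : card s = 4) (hpf : ¬ HasPair s) {y : ZMod m} (hy : y ∈ s)
    (hy2 : ¬ 2 ∣ y.val) (hy3 : ¬ 3 ∣ y.val) (htwin : count (y + 3 * 𝔫) s = count y s) :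
    ∃ z w : ZMod m, s = y ::ₘ (y + 3 * 𝔫) ::ₘ {z, w} ∧ z + w = -(2 * y + 3 * 𝔫) ∧ (2 ∣ z.val ∧ 2 ∣ w.val) ∧
      ¬ (3 ∣ z.val ∧ 3 ∣ w.val) := by
  classical
  have hn0 := n_pos hn
  have h3 := three_dvd_n hn hk
  have h2n := two_dvd_n hn hi
  have hcy : count y s = 1 := count_eq_one_of_twin hm hn hk hs hcard hy hy3 htwin
  have hcB : count (y + 3 * 𝔫) s = 1 := by rw [htwin, hcy]
  have hyB : y ≠ y + 3 * 𝔫 := by simpa using add_mul_n_ne hm hn0 y (j := 0) (l := 3) (by omega) (by omega) (by omega)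
  obtain ⟨z, w, hs4⟩ := exists_eq_of_two_mem hcard hy (Multiset.one_le_count_iff_mem.mp (by omega)) hyB
  have hsum : s.sum = 0 := hs.1.2
  have hzw : z + w = -(2 * y + 3 * 𝔫) := by
    rw [hs4, sum_four'] at hsum
    linear_combination hsum
  -- neither `z` nor `w` is a unit
  have hz := not_unit_of_twin hm hn hi hk hs hcard hpf hy3 hs4 hcy hcB hzw
  have hs4' : s = y ::ₘ (y + 3 * 𝔫) ::ₘ {w, z} := by rw [hs4, Multiset.pair_comm]
  have hw := not_unit_of_twin hm hn hi hk hs hcard hpf hy3 hs4' hcy hcB (by rw [add_comm]; exact hzw)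
  -- reduce modulo `3` and modulo `2`
  have h3m := three_dvd_m hm
  have h2m := two_dvd_m hm
  set ρ := ZMod.castHom h3m (ZMod 3) with hρ
  set σ := ZMod.castHom h2m (ZMod 2) with hσ
  have ρn : ρ 𝔫 = 0 := by rw [map_natCast, ZMod.natCast_eq_zero_iff]; exact h3
  have σn : σ 𝔫 = 0 := by rw [map_natCast, ZMod.natCast_eq_zero_iff]; exact h2n
  have ρy : ρ y ≠ 0 := fun e ↦ hy3 ((dvd_val_iff_cast h3m y).mpr e)
  have σy : σ y ≠ 0 := fun e ↦ hy2 ((dvd_val_iff_cast h2m y).mpr e)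
  have eρ := congrArg ρ hzw
  have eσ := congrArg σ hzw
  rw [_root_.map_add, _root_.map_neg, _root_.map_add, _root_.map_mul, _root_.map_mul, ρn, map_ofNat, map_ofNat] at eρ
  rw [_root_.map_add, _root_.map_neg, _root_.map_add, _root_.map_mul, _root_.map_mul, σn, map_ofNat, map_ofNat] at eσ
  have not33 : ¬ (3 ∣ z.val ∧ 3 ∣ w.val) := by
    rintro ⟨hz3, hw3⟩
    have key : ∀ a b c : ZMod 3, c ≠ 0 → a + b = -(2 * c + 3 * 0) → ¬ (a = 0 ∧ b = 0) := by decide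
    exact key _ _ _ ρy eρ ⟨(dvd_val_iff_cast h3m z).mp hz3, (dvd_val_iff_cast h3m w).mp hw3⟩
  refine ⟨z, w, hs4, hzw, ?_, not33⟩
  have key2 : ∀ a b c : ZMod 2, a + b = -(2 * c + 3 * 0) → a = b := by decide
  have ezw : σ z = σ w := key2 _ _ _ eσ
  by_cases hz2 : 2 ∣ z.val
  · have : σ w = 0 := by rw [← ezw]; exact (dvd_val_iff_cast h2m z).mp hz2
    exact ⟨hz2, (dvd_val_iff_cast h2m w).mpr this⟩
  · exfalso
    have hw2 : ¬ 2 ∣ w.val := fun h ↦ hz2 ((dvd_val_iff_cast h2m z).mpr (by rw [ezw]; exact (dvd_val_iff_cast h2m w).mp h))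
    exact not33 ⟨hz.resolve_left hz2, hw.resolve_left hw2⟩

end TwoThreePower

end Literature.AlgebraicGeometry.Shioda1982
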